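import Literature.Probability.Percolation.ZdFiveArmUpperBoundProofsE
import Literature.Probability.Percolation.ArmSeparationSchemeFin
import HarnessLib

/-!
# The five-arm upper bound on `ℤ²` from the inputs of Kesten's arm-separation scheme

Topic `Literature/Probability/Percolation`; critical bond percolation on `ℤ²`
(`P = P_{1/2} = bondPercolation (zdGraph 2) half`). PROOFS ONLY (no definition, no named fact).

After `DuminilCopinManolescuTassion2021_zdFiveArm_upperBound_of_separationE'`
(`ZdFiveArmUpperBoundProofsE.lean`) the named fact
`DuminilCopinManolescuTassion2021_zdFiveArm_upperBound` (DMT 2021, Prop. 6.6, `q = 1`, five arms)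
rests on exactly one input, Kesten's arm separation for five arms of bond percolation on `ℤ²` in
the fenced, landed, edge-disjoint form `zdFiveArmSepE` (`ZdFiveArmSeparatedE.lean`):

  `(S₅)  ∃ c > 0, ∃ n₀, ∀ n ≥ n₀, ∀ N ≥ 2n, c · P(zdFiveArmClusters n N) ≤ P(zdFiveArmSepE n N)`.

This file splits `(S₅)` along the architecture already used in the tree for FOUR arms
(`ZdFourArmSepInwardScheme.lean`: external half, then the inward multi-scale scheme of
Kesten 1987, §2, Lemma 5 / Nolin 2008, §4.4, proof of Thm. 11, "2. Internal extremities", summed by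
the lattice-free `le_mul_of_separationScheme_upto` of `ArmSeparationSchemeFin.lean`), with the
intermediate "outer-landed" event family kept ABSTRACT (`O : ℕ → ℕ → Set _`, inner radius and outer
radius; the four-arm instance is `zdFourArmOutLanded`), so that the five-arm instantiation only has
to supply the event-specific inputs:

* `exists_real_le_mul_of_inwardScheme` — for event families `O` (non-decreasing in the inner
  radius) and `S`: the inward extension `P(S m N) ≤ C₀ P(S m' N)` (`2m' ≤ m ≤ 4m'`), the initial
  scale `c ≤ P(S m N)` (`2m ≤ N ≤ 8m`), and for every `ε > 0` an event family `G` with the inner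
  step `P(O m N) ≤ P(G m N) + ε P(O 2m N)` and the inner landing `P(G 2m N) ≤ C₁(ε) P(S m N)` give
  `∃ C n₀, ∀ n ≥ n₀, ∀ N ≥ 2n, P(O n N) ≤ C · P(S n N)` (verbatim generalisation of
  `exists_real_zdFourArmOutLanded_le_mul_zdFourArmSep`);
* `DuminilCopinManolescuTassion2021_zdFiveArm_upperBound_of_separationInputs` — the named fact
  from the external half `P(zdFiveArmClusters n N) ≤ C · P(O n N)` and the four inward inputs for
  `S = zdFiveArmSepE`.

## References

* H. Kesten, *Scaling relations for 2D-percolation*, CMP 109 (1987), §2, Lemmas 4–6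
  [KestenScalingCMP1987].
* P. Nolin, *Near-critical percolation in two dimensions*, EJP 13 (2008), §4.4 Thm. 11 and its
  proof, Lemmas 14–15 (arXiv 0711.4948: Thm. 10, pp. 11–13) [Nolin2008].
* H. Duminil-Copin, I. Manolescu, V. Tassion, PTRF 181 (2021), §6.2 Prop. 6.3, Prop. 6.5, §6.3
  Prop. 6.6 [DuminilCopinManolescuTassion2021].
-/

noncomputable section

open MeasureTheory Set

namespace Literature.Probability.Percolation

open LatticeModels

/-- **The inward multi-scale summation for abstract event families** (the ladder
`m_K = n · 2^{L-K}`, `1 ≤ L`, `4 m₁ ≤ N ≤ 8 m₁` for `m₁ = n · 2^{L-1}`): as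
`real_zdFourArmOutLanded_ladder_le` with `zdFourArmOutLanded ↦ O`, `zdFourArmSep ↦ S`.
[cite: Nolin2008, §4.4, proof of Thm. 11, internal extremities (arXiv 0711.4948: Thm. 10, p. 13)] [cite: KestenScalingCMP1987, §2 Lemma 5] -/
theorem real_ladder_le_of_inwardInputs (O S : ℕ → ℕ → Set (BondConfig (Site 2)))
    (hmono : ∀ m m' N : ℕ, m' ≤ m → O m' N ⊆ O m N) {n₁ n N L : ℕ} (hn : n₁ ≤ n) (hL : 1 ≤ L)
    (hNlo : 4 * (n * 2 ^ (L - 1)) ≤ N) (hNhi : N ≤ 8 * (n * 2 ^ (L - 1)))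
    {G : ℕ → ℕ → Set (BondConfig (Site 2))} {ε C₀ C₁ c : ℝ}
    (hε : 0 ≤ ε) (hC₀ : 1 ≤ C₀) (hC₁ : 0 ≤ C₁) (hc : 0 < c) (hsmall : ε * C₀ ^ 2 ≤ 1 / 2)
    (hext : ∀ m m' N' : ℕ, n₁ ≤ m' → 2 * m' ≤ m → m ≤ 4 * m' → 2 * m ≤ N' →
      (bondPercolation (zdGraph 2) half).real (S m N') ≤
        C₀ * (bondPercolation (zdGraph 2) half).real (S m' N'))
    (hinit : ∀ m N' : ℕ, n₁ ≤ m → 2 * m ≤ N' → N' ≤ 8 * m →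
      c ≤ (bondPercolation (zdGraph 2) half).real (S m N'))
    (hstep : ∀ m : ℕ, n ≤ m → 4 * m ≤ N →
      (bondPercolation (zdGraph 2) half).real (O m N) ≤
        (bondPercolation (zdGraph 2) half).real (G m N) +
          ε * (bondPercolation (zdGraph 2) half).real (O (2 * m) N))
    (hland : ∀ m : ℕ, n ≤ m → 4 * m ≤ N →
      (bondPercolation (zdGraph 2) half).real (G (2 * m) N) ≤
        C₁ * (bondPercolation (zdGraph 2) half).real (S m N)) :
    ∀ K, 1 ≤ K → K ≤ L →
      (bondPercolation (zdGraph 2) half).real (O (n * 2 ^ (L - K)) N) ≤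
        (2 * C₁ + 1 / c) * (bondPercolation (zdGraph 2) half).real (S (n * 2 ^ (L - K)) N) := by
  set μ := bondPercolation (zdGraph 2) half with hμ
  set m : ℕ → ℕ := fun K => n * 2 ^ (L - K) with hm
  have hsucc : ∀ K, K + 1 ≤ L → m K = 2 * m (K + 1) := by
    intro K hK
    simp only [hm]
    rw [show L - K = L - (K + 1) + 1 by omega, pow_succ]
    ring
  have hle1 : ∀ K, 1 ≤ K → m K ≤ n * 2 ^ (L - 1) := by
    intro K hK
    exact Nat.mul_le_mul_left _ (Nat.pow_le_pow_right (by norm_num) (by omega))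
  have hge : ∀ K, n ≤ m K := fun K => Nat.le_mul_of_pos_right _ (Nat.two_pow_pos _)
  have hm1 : m 1 = n * 2 ^ (L - 1) := rfl
  have hinit1 : c ≤ μ.real (S (m 1) N) := by
    have := hge 1
    rw [hm1] at this ⊢
    exact hinit _ N (by omega) (by omega) hNhi
  intro K hK hKL
  have key := le_mul_of_separationScheme_upto (f := fun K => μ.real (O (m K) N))
    (g := fun K => μ.real (G (m K) N)) (h := fun K => μ.real (S (m K) N)) (k := 0) (L := L)
    hε hC₀ hC₁ hc hsmall (fun K => measureReal_le_one) (fun K => measureReal_nonneg) (by omega)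
    (fun K hK1 hKL => by
      exact measureReal_mono (hmono _ _ _ (by rw [hsucc K hKL]; omega)) (measure_ne_top _ _))
    (fun K _ hKL => by
      have h1 := hle1 (K + 1) (by omega)
      have h2 := hge (K + 1)
      have := hstep (m (K + 1)) h2 (by omega)
      rwa [← hsucc K hKL] at this)
    (fun K hK1 hKL => by
      have h1 := hle1 (K + 1) (by omega)
      have h2 := hge (K + 1)
      have := hland (m (K + 1)) h2 (by omega)
      rwa [← hsucc K hKL] at this)
    (fun K hK1 hKL => by
      have h1 := hle1 K hK1
      have h2 := hge (K + 1)
      exact hext (m K) (m (K + 1)) N (by omega) (by rw [hsucc K hKL]) (by rw [hsucc K hKL]; omega) (by omega))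
    hinit1 K (by omega) hKL
  exact key

/-- **The internal half of Kesten's arm separation, abstract form**: for event families `O`
(non-decreasing in the inner radius) and `S` with the inward extension and initial-scale estimates
for `S` (from the inner radius `n₁` on), if for every `ε > 0` there are `C₁ ≥ 0`, `n₂` and events
`G m N` with the inner step `P(O m N) ≤ P(G m N) + ε · P(O 2m N)` and the inner landing
`P(G 2m N) ≤ C₁ · P(S m N)` for `n₂ ≤ m`, `4m ≤ N`, then
`∃ C n₀, ∀ n ≥ n₀, ∀ N ≥ 2n, P(O n N) ≤ C · P(S n N)`
(the four-arm instance is `exists_real_zdFourArmOutLanded_le_mul_zdFourArmSep`). [cite: Nolin2008, §4.4, proof of Thm. 11, internal extremities (arXiv 0711.4948: Thm. 10, p. 13)] [cite: KestenScalingCMP1987, §2 Lemma 5] -/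
theorem exists_real_le_mul_of_inwardScheme (O S : ℕ → ℕ → Set (BondConfig (Site 2)))
    (hmono : ∀ m m' N : ℕ, m' ≤ m → O m' N ⊆ O m N) {n₁ : ℕ} {C₀ c : ℝ} (hC₀ : 1 ≤ C₀) (hc : 0 < c)
    (hext : ∀ m m' N' : ℕ, n₁ ≤ m' → 2 * m' ≤ m → m ≤ 4 * m' → 2 * m ≤ N' →
      (bondPercolation (zdGraph 2) half).real (S m N') ≤
        C₀ * (bondPercolation (zdGraph 2) half).real (S m' N'))
    (hinit : ∀ m N' : ℕ, n₁ ≤ m → 2 * m ≤ N' → N' ≤ 8 * m →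
      c ≤ (bondPercolation (zdGraph 2) half).real (S m N'))
    (hin : ∀ ε : ℝ, 0 < ε → ∃ (C₁ : ℝ) (n₂ : ℕ) (G : ℕ → ℕ → Set (BondConfig (Site 2))), 0 ≤ C₁ ∧
      (∀ m N : ℕ, n₂ ≤ m → 4 * m ≤ N →
        (bondPercolation (zdGraph 2) half).real (O m N) ≤
          (bondPercolation (zdGraph 2) half).real (G m N) +
            ε * (bondPercolation (zdGraph 2) half).real (O (2 * m) N)) ∧
      (∀ m N : ℕ, n₂ ≤ m → 4 * m ≤ N →
        (bondPercolation (zdGraph 2) half).real (G (2 * m) N) ≤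
          C₁ * (bondPercolation (zdGraph 2) half).real (S m N))) :
    ∃ (C : ℝ) (n₀ : ℕ), 0 < C ∧ ∀ n N : ℕ, n₀ ≤ n → 2 * n ≤ N →
      (bondPercolation (zdGraph 2) half).real (O n N) ≤
        C * (bondPercolation (zdGraph 2) half).real (S n N) := by
  set μ := bondPercolation (zdGraph 2) half with hμ
  have hε : 0 < 1 / (2 * C₀ ^ 2) := by positivity
  obtain ⟨C₁, n₂, G, hC₁, hstep, hland⟩ := hin (1 / (2 * C₀ ^ 2)) hε
  refine ⟨max (2 * C₁ + 1 / c) (1 / c), max (max n₁ 1) n₂, by positivity, fun n N hn hN => ?_⟩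
  have hn₁ : n₁ ≤ n := le_trans (le_max_left _ _) (le_of_max_le_left hn)
  have hn1 : 1 ≤ n := le_trans (le_max_right _ _) (le_of_max_le_left hn)
  have hn₂ : n₂ ≤ n := le_of_max_le_right hn
  by_cases hN4 : N < 4 * n
  · have h1 : c ≤ μ.real (S n N) := hinit n N hn₁ hN (by omega)
    calc μ.real (O n N) ≤ 1 := measureReal_le_one
      _ ≤ 1 / c * μ.real (S n N) := by
          rw [one_div_mul_eq_div, le_div_iff₀ hc, one_mul]; exact h1
      _ ≤ max (2 * C₁ + 1 / c) (1 / c) * μ.real (S n N) :=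
          mul_le_mul_of_nonneg_right (le_max_right _ _) measureReal_nonneg
  · have hN4 : 4 * n ≤ N := not_lt.1 hN4
    set t : ℕ := N / (4 * n) with ht
    have ht1 : 1 ≤ t := (Nat.le_div_iff_mul_le (by omega)).2 (by omega)
    set j : ℕ := Nat.log 2 t with hj
    have hj1 : 2 ^ j ≤ t := Nat.pow_log_le_self 2 (by omega)
    have hj2 : t < 2 ^ (j + 1) := Nat.lt_pow_succ_log_self (by norm_num) t
    have htN : 4 * n * t ≤ N := by rw [ht]; exact Nat.mul_div_le N (4 * n)
    have hNt : N < 4 * n * (t + 1) := by rw [ht]; exact Nat.lt_mul_div_succ N (by omega)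
    have hNlo : 4 * (n * 2 ^ (j + 1 - 1)) ≤ N := by
      rw [Nat.add_sub_cancel]
      calc 4 * (n * 2 ^ j) = 4 * n * 2 ^ j := by ring
        _ ≤ 4 * n * t := Nat.mul_le_mul_left _ hj1
        _ ≤ N := htN
    have hNhi : N ≤ 8 * (n * 2 ^ (j + 1 - 1)) := by
      rw [Nat.add_sub_cancel]
      have : 4 * n * (t + 1) ≤ 4 * n * 2 ^ (j + 1) := Nat.mul_le_mul_left _ hj2
      calc N ≤ 4 * n * (t + 1) := hNt.le
        _ ≤ 4 * n * 2 ^ (j + 1) := this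
        _ = 8 * (n * 2 ^ j) := by rw [pow_succ]; ring
    have hsmall : 1 / (2 * C₀ ^ 2) * C₀ ^ 2 ≤ 1 / 2 := by
      rw [le_div_iff₀ (by norm_num : (0 : ℝ) < 2)]
      have hC : (0 : ℝ) < C₀ ^ 2 := by positivity
      rw [div_mul_eq_mul_div, one_mul, div_mul_eq_mul_div, div_le_iff₀ (by positivity)]
      nlinarith
    have key := real_ladder_le_of_inwardInputs O S hmono (G := G) hn₁ (Nat.le_add_left 1 j) hNlo hNhi
      hε.le hC₀ hC₁ hc hsmall hext hinit
      (fun m hm h4 => hstep m N (hn₂.trans hm) h4) (fun m hm h4 => hland m N (hn₂.trans hm) h4)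
      (j + 1) (Nat.le_add_left 1 j) le_rfl
    rw [Nat.sub_self, pow_zero, mul_one] at key
    exact key.trans (mul_le_mul_of_nonneg_right (le_max_left _ _) measureReal_nonneg)

/-- **DMT 2021, Prop. 6.6 (five arms, upper bound, `q = 1`) from the inputs of Kesten's
arm-separation scheme.**  Given an intermediate event family `O n N` (the five arms of
`zdFiveArmClusters n N` fenced and landed on the OUTER square; non-decreasing in the inner radius)
with the external half `P(zdFiveArmClusters n N) ≤ C · P(O n N)` (Kesten 1987, Lemma 4; Nolin 2008,
§4.4, "1. External extremities"), and for `S = zdFiveArmSepE` the inward extension, the initial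
scale, and the inner step-and-landing inputs (ibid., "2. Internal extremities", Lemmas 14–15), the
named fact follows through `exists_real_le_mul_of_inwardScheme` and
`DuminilCopinManolescuTassion2021_zdFiveArm_upperBound_of_separationE'`. [cite: DuminilCopinManolescuTassion2021, §6.3 Prop. 6.6 (proof via Prop. 6.3, Prop. 6.5), q = 1] [cite: Nolin2008, §4.4 Thm. 11 (arXiv 0711.4948: Thm. 10)] -/
theorem DuminilCopinManolescuTassion2021_zdFiveArm_upperBound_of_separationInputs
    (O : ℕ → ℕ → Set (BondConfig (Site 2))) (hmono : ∀ m m' N : ℕ, m' ≤ m → O m' N ⊆ O m N)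
    (hout : ∃ (C : ℝ) (n₀ : ℕ), 0 < C ∧ ∀ n N : ℕ, n₀ ≤ n → 2 * n ≤ N →
      (bondPercolation (zdGraph 2) half).real (zdFiveArmClusters n N) ≤
        C * (bondPercolation (zdGraph 2) half).real (O n N))
    {n₁ : ℕ} {C₀ c : ℝ} (hC₀ : 1 ≤ C₀) (hc : 0 < c)
    (hext : ∀ m m' N' : ℕ, n₁ ≤ m' → 2 * m' ≤ m → m ≤ 4 * m' → 2 * m ≤ N' →
      (bondPercolation (zdGraph 2) half).real (zdFiveArmSepE m N') ≤
        C₀ * (bondPercolation (zdGraph 2) half).real (zdFiveArmSepE m' N'))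
    (hinit : ∀ m N' : ℕ, n₁ ≤ m → 2 * m ≤ N' → N' ≤ 8 * m →
      c ≤ (bondPercolation (zdGraph 2) half).real (zdFiveArmSepE m N'))
    (hin : ∀ ε : ℝ, 0 < ε → ∃ (C₁ : ℝ) (n₂ : ℕ) (G : ℕ → ℕ → Set (BondConfig (Site 2))), 0 ≤ C₁ ∧
      (∀ m N : ℕ, n₂ ≤ m → 4 * m ≤ N →
        (bondPercolation (zdGraph 2) half).real (O m N) ≤
          (bondPercolation (zdGraph 2) half).real (G m N) +
            ε * (bondPercolation (zdGraph 2) half).real (O (2 * m) N)) ∧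
      (∀ m N : ℕ, n₂ ≤ m → 4 * m ≤ N →
        (bondPercolation (zdGraph 2) half).real (G (2 * m) N) ≤
          C₁ * (bondPercolation (zdGraph 2) half).real (zdFiveArmSepE m N))) :
    DuminilCopinManolescuTassion2021_zdFiveArm_upperBound := by
  obtain ⟨C, n₀, hC, hout⟩ := hout
  obtain ⟨C', n₀', hC', hin'⟩ := exists_real_le_mul_of_inwardScheme O zdFiveArmSepE hmono hC₀ hc hext hinit hin
  refine DuminilCopinManolescuTassion2021_zdFiveArm_upperBound_of_separationE'
    ⟨1 / (C * C'), by positivity, max n₀ n₀', fun n N hn hN => ?_⟩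
  have h1 := hout n N (le_of_max_le_left hn) hN
  have h2 := hin' n N (le_of_max_le_right hn) hN
  rw [one_div_mul_eq_div, div_le_iff₀ (by positivity)]
  calc (bondPercolation (zdGraph 2) half).real (zdFiveArmClusters n N)
      ≤ C * (C' * (bondPercolation (zdGraph 2) half).real (zdFiveArmSepE n N)) :=
        h1.trans (mul_le_mul_of_nonneg_left h2 hC.le)
    _ = (bondPercolation (zdGraph 2) half).real (zdFiveArmSepE n N) * (C * C') := by ring

end Literature.Probability.Percolation
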